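import Mathlib.LinearAlgebra.Matrix.Permanent
import Mathlib.LinearAlgebra.Matrix.Determinant.Basic
import Mathlib.LinearAlgebra.Matrix.SchurComplement
import Mathlib.LinearAlgebra.Matrix.Block
import Mathlib.GroupTheory.Perm.Support
import Mathlib.RingTheory.MvPolynomial.Basic
import Literature.Computability.AlgebraicComplexity.ValiantClasses

/-!
# The Pfaffian cover of a ranked branching program

Helper file for item stmt-ValiantsHypothesis-7424 (`PfaffianNormalForm`, route PolyaContinued;
support lemmas, part 1 of 2).

## The cover pattern and its signing

Let `κ` be a finite index set with a distinguished element `o` (the *super-vertex*) and a rank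
function `r : κ → ℕ`. The *cover pattern* `E ⊆ κ × κ` consists of the pairs `(p, q)` (row `p`,
column `q`) with
* `p ≠ o`, `q = o` (edges into the super-vertex),
* `p = o`, `q ≠ o` (edges out of the super-vertex),
* `p, q ≠ o` and (`p = q` — the idle loops — or `r p < r q` — the arcs of a DAG ranked by `r`,
  read from the column to the row the rank decreases).

A permutation `π` of `κ` supported on `E` (`(π i, i) ∈ E` for all `i`) is a single cycle through
`o` together with fixed points, so its sign is `(-1)^{#supp π - 1}`; equivalently
`sign π = ∏ᵢ s (π i, i)` for the signing `s (p, q) = -1` iff `p ≠ o ∧ p ≠ q`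
(`sign_eq_prod_of_coverSupported`, induction on the support, shortening the cycle through `o` by
a transposition). Consequently the signed symbolic matrix of `E` has determinant equal to the
permanent of the unsigned one (`det_signed_cover_eq_permanent`): the bipartite graph `E` is
Pfaffian — the split-graph/Kasteleyn signing of an algebraic branching program (arcs `-1`, idle
edges `+1`).

## The cover

Let `Λ` be the weighted adjacency matrix of an acyclic digraph on a finite set `ι`
(`Λ i j ≠ 0 → r i < r j`) over `k[X_σ]`, with weights that are single variables or constants, let
`(1 - Λ) G = 1` and let `v`, `w` be vectors of variables/constants. The value `f = vᵀ G w` (sum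
over paths of the products of the weights) is a Valiant projection of `per (X|_E)` for the cover
pattern `E` on `ι ⊕ Unit ≃ Fin (#ι + 1)` ranked by `r` (`exists_pfaffianCover_of_ranked`): map the
SIGNED matrix, whose determinant is `per (X|_E)`, to `[[1 - Λ, -w], [vᵀ, 0]]`, of determinant
`det (1 - Λ) · vᵀ (1 - Λ)⁻¹ w = f` (Schur complement; `det (1 - Λ) = 1` by
`det_one_sub_eq_one_of_ranked`). Cf. Valiant 1979 (universality of the determinant via branching
programs), Little 1975 / Kasteleyn (Pfaffian signings).
-/

-- single-conjunct layout: Sub = Summit, duplicated namespace component intended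
set_option linter.dupNamespace false

namespace Summit.ValiantsHypothesis.ValiantsHypothesis.Theorems.PolyaContinued

open Equiv Finset MvPolynomial Matrix

/-- **Sign lemma.** If a permutation `π` of `κ` is supported on the cover pattern of `(o, r)`
(every pair `(π i, i)` is an edge into/out of the super-vertex `o`, an idle loop, or an arc along
which the rank strictly decreases from column to row), then
`sign π = ∏ᵢ (if π i ≠ o ∧ π i ≠ i then -1 else 1)`. [folklore] -/
theorem sign_eq_prod_of_coverSupported {κ : Type*} [Fintype κ] [DecidableEq κ]
    (o : κ) (r : κ → ℕ) (π : Perm κ)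
    (hπ : ∀ i, (π i ≠ o ∧ i = o) ∨ (π i = o ∧ i ≠ o) ∨
      (π i ≠ o ∧ i ≠ o ∧ (π i = i ∨ r (π i) < r i))) :
    ((Perm.sign π : ℤˣ) : ℤ) = ∏ i, (if π i ≠ o ∧ π i ≠ i then (-1 : ℤ) else 1) := by
  -- strong induction on the cardinality of the support
  suffices h : ∀ (n : ℕ) (π : Perm κ), #π.support ≤ n →
      (∀ i, (π i ≠ o ∧ i = o) ∨ (π i = o ∧ i ≠ o) ∨
        (π i ≠ o ∧ i ≠ o ∧ (π i = i ∨ r (π i) < r i))) →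
      ((Perm.sign π : ℤˣ) : ℤ) = ∏ i, (if π i ≠ o ∧ π i ≠ i then (-1 : ℤ) else 1) from
    h _ π le_rfl hπ
  intro n
  induction n with
  | zero =>
    intro π hcard hπ
    have h1 : π = 1 := Perm.card_support_eq_zero.1 (Nat.le_zero.1 hcard)
    rcases hπ o with h | h | h
    · exact (h.1 (by simp [h1])).elim
    · exact absurd rfl h.2
    · exact absurd rfl h.2.1
  | succ n ih =>
    intro π hcard hπ
    -- `a₁ = π o ≠ o`
    have ha₁ : π o ≠ o := by
      rcases hπ o with h | h | h
      · exact h.1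
      · exact absurd rfl h.2
      · exact absurd rfl h.2.1
    rcases hπ (π o) with h | h | h
    · exact absurd h.2 ha₁
    · -- Case B: `π (π o) = o`, so `π = swap o (π o)`
      have hπeq : π = swap o (π o) := by
        ext x
        by_cases hxo : x = o
        · subst hxo; rw [swap_apply_left]
        by_cases hxa : x = π o
        · rw [hxa, swap_apply_right]; exact h.1
        rw [swap_apply_of_ne_of_ne hxo hxa]
        -- all other points are fixed: take a non-fixed one of minimal rank
        by_contra hx
        obtain ⟨y, hyS, hymin⟩ := Finset.exists_min_image
          (Finset.univ.filter fun y => y ≠ o ∧ y ≠ π o ∧ π y ≠ y) r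
          ⟨x, by simp [hxo, hxa, hx]⟩
        simp only [Finset.mem_filter, Finset.mem_univ, true_and] at hyS
        obtain ⟨hyo, hya, hyy⟩ := hyS
        rcases hπ y with h' | h' | h'
        · exact hyo h'.2
        · exact hya (π.injective (h'.1.trans h.1.symm))
        · rcases h'.2.2 with h'' | h''
          · exact hyy h''
          · have hmem : π y ∈ Finset.univ.filter fun y => y ≠ o ∧ y ≠ π o ∧ π y ≠ y := by
              simp only [Finset.mem_filter, Finset.mem_univ, true_and]
              refine ⟨h'.1, fun hh => hyo (π.injective hh), fun hh => hyy (π.injective hh)⟩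
            exact absurd (hymin _ hmem) (not_le.2 h'')
      have hsign : ((Perm.sign π : ℤˣ) : ℤ) = -1 := by
        rw [hπeq, Perm.sign_swap ha₁.symm, Units.val_neg, Units.val_one]
      rw [hsign, Finset.prod_eq_single_of_mem o (Finset.mem_univ o)]
      · rw [if_pos ⟨ha₁, ha₁⟩]
      · intro i _ hio
        rw [if_neg]
        by_cases hia : i = π o
        · rw [hia, h.1]; exact fun hh => hh.1 rfl
        · have : π i = i := by
            have := congrFun (congrArg (⇑) hπeq) i
            rwa [swap_apply_of_ne_of_ne hio hia] at this
          exact fun hh => hh.2 this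
    · -- Case C: `π (π o) = a₂` with `a₂ ≠ o` and `r a₂ < r (π o)`
      obtain ⟨ha₂o, -, h3⟩ := h
      have hne : π (π o) ≠ π o := by
        rcases h3 with h3 | h3
        · exact (ha₁ (π.injective h3)).elim
        · intro hh
          rw [hh] at h3
          exact lt_irrefl _ h3
      set π' : Perm κ := swap (π o) (π (π o)) * π with hπ'
      have hcard' : #π'.support ≤ n :=
        Nat.lt_succ_iff.1 (lt_of_lt_of_le (Perm.card_support_swap_mul hne) hcard)
      have hπ'o : π' o = π (π o) := by
        simp only [hπ', Perm.coe_mul, Function.comp_apply, swap_apply_left]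
      have hπ'a : π' (π o) = π o := by
        simp only [hπ', Perm.coe_mul, Function.comp_apply, swap_apply_right]
      have hπ'x : ∀ x, x ≠ o → x ≠ π o → π' x = π x := by
        intro x hxo hxa
        simp only [hπ', Perm.coe_mul, Function.comp_apply]
        refine swap_apply_of_ne_of_ne ?_ ?_
        · exact fun hh => hxo (π.injective hh)
        · exact fun hh => hxa (π.injective hh)
      have hsupp' : ∀ i, (π' i ≠ o ∧ i = o) ∨ (π' i = o ∧ i ≠ o) ∨
          (π' i ≠ o ∧ i ≠ o ∧ (π' i = i ∨ r (π' i) < r i)) := by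
        intro i
        by_cases hio : i = o
        · subst hio; exact Or.inl ⟨by rwa [hπ'o], rfl⟩
        by_cases hia : i = π o
        · subst hia; exact Or.inr (Or.inr ⟨by rwa [hπ'a], ha₁, Or.inl hπ'a⟩)
        rw [hπ'x i hio hia]
        exact hπ i
      have hIH := ih π' hcard' hsupp'
      -- signs: `sign π' = - sign π`
      have hsign : ((Perm.sign π : ℤˣ) : ℤ) = -((Perm.sign π' : ℤˣ) : ℤ) := by
        rw [hπ', Perm.sign_mul, Perm.sign_swap hne.symm, Units.val_mul, Units.val_neg,
          Units.val_one]
        ring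
      -- products: they differ exactly at `i = π o`
      have hprod : ∏ i, (if π i ≠ o ∧ π i ≠ i then (-1 : ℤ) else 1) =
          -∏ i, (if π' i ≠ o ∧ π' i ≠ i then (-1 : ℤ) else 1) := by
        rw [← Finset.mul_prod_erase _ _ (Finset.mem_univ (π o)),
          ← Finset.mul_prod_erase _ _ (Finset.mem_univ (π o)), if_pos ⟨ha₂o, hne⟩, hπ'a,
          if_neg (fun hh => hh.2 rfl)]
        rw [neg_one_mul, one_mul]
        congr 1
        refine Finset.prod_congr rfl fun i hi => ?_
        have hia : i ≠ π o := Finset.ne_of_mem_erase hi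
        by_cases hio : i = o
        · -- here `i = o`: the factors are `s (π o, o) = -1` and `s (π (π o), o) = -1`
          rw [hio, hπ'o, if_pos ⟨ha₁, ha₁⟩, if_pos ⟨ha₂o, ha₂o⟩]
        · rw [hπ'x i hio hia]
      rw [hsign, hIH, hprod]

/-- **The cover pattern is Pfaffian.** For the cover pattern `E` of `(o, r)` and the signing
`s (p, q) = -1` iff `p ≠ o ∧ p ≠ q` (arcs and the edges into the super-vertex get `-1`, idle loops
and the edges out of the super-vertex get `+1`), the signed symbolic matrix supported on `E` has
determinant equal to the permanent of the unsigned symbolic matrix (Kasteleyn/Little signing of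
the split graph of an acyclic digraph). [folklore] -/
theorem det_signed_cover_eq_permanent {k : Type*} [CommRing k] {κ : Type*} [Fintype κ]
    [DecidableEq κ] (o : κ) (r : κ → ℕ) (E : Finset (κ × κ))
    (hE : ∀ p q, (p, q) ∈ E ↔
      ((p ≠ o ∧ q = o) ∨ (p = o ∧ q ≠ o) ∨ (p ≠ o ∧ q ≠ o ∧ (p = q ∨ r p < r q))))
    (s : κ × κ → k) (hs : ∀ p q, s (p, q) = if p ≠ o ∧ p ≠ q then -1 else 1) :
    (Matrix.of fun i j => if (i, j) ∈ E then C (s (i, j)) * X (i, j) else 0 :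
        Matrix κ κ (MvPolynomial (κ × κ) k)).det =
      (Matrix.of fun i j => if (i, j) ∈ E then X (i, j) else 0 :
        Matrix κ κ (MvPolynomial (κ × κ) k)).permanent := by
  rw [Matrix.det_apply, Matrix.permanent]
  refine Finset.sum_congr rfl fun π _ => ?_
  by_cases hsupp : ∀ i, (π i, i) ∈ E
  · have hπ : ∀ i, (π i ≠ o ∧ i = o) ∨ (π i = o ∧ i ≠ o) ∨
        (π i ≠ o ∧ i ≠ o ∧ (π i = i ∨ r (π i) < r i)) := fun i => (hE _ _).1 (hsupp i)
    have hsign := sign_eq_prod_of_coverSupported o r π hπ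
    simp only [Matrix.of_apply]
    rw [Finset.prod_congr rfl fun i _ => if_pos (hsupp i),
      Finset.prod_congr rfl fun i _ => if_pos (hsupp i), Finset.prod_mul_distrib]
    have hC : ∏ i, C (s (π i, i)) =
        (((∏ i, (if π i ≠ o ∧ π i ≠ i then (-1 : ℤ) else 1) : ℤ) : MvPolynomial (κ × κ) k)) := by
      rw [Int.cast_prod]
      refine Finset.prod_congr rfl fun i _ => ?_
      rw [hs]
      split_ifs <;> simp
    rw [hC, ← hsign, Units.smul_def, zsmul_eq_mul, ← mul_assoc, ← Int.cast_mul, ← Units.val_mul,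
      Int.units_mul_self, Units.val_one, Int.cast_one, one_mul]
  · obtain ⟨i, hi⟩ := not_forall.1 hsupp
    simp only [Matrix.of_apply]
    rw [Finset.prod_eq_zero (Finset.mem_univ i) (if_neg hi),
      Finset.prod_eq_zero (Finset.mem_univ i) (if_neg hi), smul_zero]

/-! ## The Pfaffian cover of a ranked branching program -/

/-- A matrix `1 - Λ` with `Λ` supported on rank-increasing pairs (`Λ i j ≠ 0 → r i < r j`) is
unipotent block-triangular, hence has determinant `1`. [folklore] -/
theorem det_one_sub_eq_one_of_ranked {R : Type*} [CommRing R] {ι : Type*} [Fintype ι]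
    [DecidableEq ι] (r : ι → ℕ) (Λ : Matrix ι ι R) (hΛr : ∀ i j, Λ i j ≠ 0 → r i < r j) :
    (1 - Λ).det = 1 := by
  have hzero : ∀ i j, ¬ r i < r j → Λ i j = 0 := fun i j h => by
    by_contra h0
    exact h (hΛr i j h0)
  have hbt : (1 - Λ).BlockTriangular r := by
    intro i j hij
    have hne : i ≠ j := fun h => by subst h; exact lt_irrefl _ hij
    rw [Matrix.sub_apply, Matrix.one_apply_ne hne, hzero i j (lt_asymm hij), sub_zero]
  rw [hbt.det]
  refine Finset.prod_eq_one fun kk _ => ?_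
  have hblk : (1 - Λ).toSquareBlock r kk = 1 := by
    ext ⟨i, hi⟩ ⟨j, hj⟩
    rw [Matrix.toSquareBlock_def, Matrix.of_apply, Matrix.sub_apply]
    have hΛ : Λ i j = 0 := hzero i j (by rw [hi, hj]; exact lt_irrefl _)
    by_cases hij : i = j
    · subst hij
      simp [hΛ]
    · rw [Matrix.one_apply_ne hij, hΛ, sub_zero, Matrix.one_apply_ne]
      exact fun h' => hij (congrArg Subtype.val h')
  rw [hblk, Matrix.det_one]

/-- **Pfaffian cover of a ranked branching program.** Let `Λ` be a matrix over `k[X_σ]` on a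
finite index set `ι`, supported on rank-increasing pairs (the weighted adjacency matrix of an
acyclic digraph) with entries that are variables or constants, let `v`, `w` be vectors of
variables or constants, and let `(1 - Λ) G = 1` (so `v ⬝ G w` is the sum over the paths of the
digraph of the products of the weights, read in at `v` and out at `w`). Then `f = v ⬝ G w` is a
projection of the perfect-matching polynomial `per (X|_E)` of a PFAFFIAN bipartite graph `E` on
`#ι + 1` + `#ι + 1` vertices: the split graph of the digraph (arc `u → u'` ↦ edge `u_out u'_in`,
idle edges `u_out u_in`) together with one super-vertex joined to everything, with the signing
arcs / in-edges of the super-vertex `-1`, idle edges / out-edges `+1`. [folklore] -/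
theorem exists_pfaffianCover_of_ranked {k : Type*} [CommRing k] {σ : Type*} {ι : Type}
    [Fintype ι] [DecidableEq ι] (r : ι → ℕ) (Λ G : Matrix ι ι (MvPolynomial σ k))
    (v w : ι → MvPolynomial σ k) (f : MvPolynomial σ k)
    (hΛr : ∀ i j, Λ i j ≠ 0 → r i < r j)
    (hΛe : ∀ i j, (∃ x, Λ i j = X x) ∨ ∃ c, Λ i j = C c)
    (hv : ∀ i, (∃ x, v i = X x) ∨ ∃ c, v i = C c)
    (hw : ∀ i, (∃ x, w i = X x) ∨ ∃ c, w i = C c)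
    (hG : (1 - Λ) * G = 1) (hf : v ⬝ᵥ (G *ᵥ w) = f) :
    ∃ (E : Finset (Fin (Fintype.card ι + 1) × Fin (Fintype.card ι + 1)))
      (P : MvPolynomial (Fin (Fintype.card ι + 1) × Fin (Fintype.card ι + 1)) k),
      P = (Matrix.of fun i j => if (i, j) ∈ E then X (i, j) else 0 :
        Matrix (Fin (Fintype.card ι + 1)) (Fin (Fintype.card ι + 1))
          (MvPolynomial (Fin (Fintype.card ι + 1) × Fin (Fintype.card ι + 1)) k)).permanent ∧
      (∃ s : Fin (Fintype.card ι + 1) × Fin (Fintype.card ι + 1) → k,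
        (∀ e, s e = 1 ∨ s e = -1) ∧
        (Matrix.of fun i j => if (i, j) ∈ E then C (s (i, j)) * X (i, j) else 0 :
          Matrix (Fin (Fintype.card ι + 1)) (Fin (Fintype.card ι + 1))
            (MvPolynomial (Fin (Fintype.card ι + 1) × Fin (Fintype.card ι + 1)) k)).det = P) ∧
      Literature.Computability.AlgebraicComplexity.IsProjection f P := by
  classical
  -- indexing: `κ = ι ⊕ Unit ≃ Fin (#ι + 1)`, super-vertex `o`
  have hcard : Fintype.card (ι ⊕ Unit) = Fintype.card ι + 1 := by
    rw [Fintype.card_sum, Fintype.card_unit]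
  set m' := Fintype.card ι + 1 with hm'
  let e : ι ⊕ Unit ≃ Fin m' := Fintype.equivFinOfCardEq hcard
  let o : Fin m' := e (Sum.inr ())
  let r' : Fin m' → ℕ := fun p => Sum.elim r (fun _ => 0) (e.symm p)
  have heo : ∀ p' : ι ⊕ Unit, e p' = o ↔ p' = Sum.inr () := fun p' => e.injective.eq_iff
  have hr' : ∀ p' : ι ⊕ Unit, r' (e p') = Sum.elim r (fun _ => 0) p' := fun p' => by
    simp [r']
  let E : Finset (Fin m' × Fin m') := Finset.univ.filter fun pq =>
    (pq.1 ≠ o ∧ pq.2 = o) ∨ (pq.1 = o ∧ pq.2 ≠ o) ∨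
      (pq.1 ≠ o ∧ pq.2 ≠ o ∧ (pq.1 = pq.2 ∨ r' pq.1 < r' pq.2))
  have hE : ∀ p q, (p, q) ∈ E ↔
      ((p ≠ o ∧ q = o) ∨ (p = o ∧ q ≠ o) ∨ (p ≠ o ∧ q ≠ o ∧ (p = q ∨ r' p < r' q))) :=
    fun p q => by simp only [E, Finset.mem_filter, Finset.mem_univ, true_and]
  let s : Fin m' × Fin m' → k := fun pq => if pq.1 ≠ o ∧ pq.1 ≠ pq.2 then -1 else 1
  have hs : ∀ p q, s (p, q) = if p ≠ o ∧ p ≠ q then -1 else 1 := fun p q => rfl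
  have hdet := det_signed_cover_eq_permanent (k := k) o r' E hE s hs
  refine ⟨E, _, rfl, ⟨s, fun pq => ?_, hdet⟩, ?_⟩
  · simp only [s]
    split_ifs
    · exact Or.inr rfl
    · exact Or.inl rfl
  -- the projection
  let proj : Fin m' × Fin m' → MvPolynomial σ k := fun pq =>
    Sum.elim (fun u => Sum.elim (fun u' => if u = u' then 1 else Λ u u') (fun _ => w u) (e.symm pq.2))
      (fun _ => Sum.elim (fun u' => v u') (fun _ => 0) (e.symm pq.2)) (e.symm pq.1)
  have hproj : ∀ p' q' : ι ⊕ Unit, proj (e p', e q') =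
      Sum.elim (fun u => Sum.elim (fun u' => if u = u' then 1 else Λ u u') (fun _ => w u) q')
        (fun _ => Sum.elim (fun u' => v u') (fun _ => 0) q') p' := fun p' q' => by
    simp [proj]
  refine ⟨proj, fun pq => ?_, ?_⟩
  · -- every substituted value is a variable or a constant
    obtain ⟨p', hp'⟩ := e.surjective pq.1
    obtain ⟨q', hq'⟩ := e.surjective pq.2
    have : pq = (e p', e q') := Prod.ext hp'.symm hq'.symm
    rw [this, hproj]
    rcases p' with u | _ <;> rcases q' with u' | _
    · simp only [Sum.elim_inl]
      by_cases huu : u = u'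
      · rw [if_pos huu]; exact Or.inr ⟨1, C_1.symm⟩
      · rw [if_neg huu]; exact hΛe u u'
    · exact hw u
    · exact hv u'
    · exact Or.inr ⟨0, C_0.symm⟩
  -- `aeval proj P = f`: map the SIGNED matrix (whose determinant is `P`) and compute a Schur
  -- complement
  have hzero : ∀ i j, ¬ r i < r j → Λ i j = 0 := fun i j h => by
    by_contra h0
    exact h (hΛr i j h0)
  let M : Matrix (ι ⊕ Unit) (ι ⊕ Unit) (MvPolynomial σ k) :=
    Matrix.fromBlocks (1 - Λ) (-Matrix.replicateCol Unit w) (Matrix.replicateRow Unit v) 0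
  have hmap : (aeval proj).mapMatrix
      (Matrix.of fun i j => if (i, j) ∈ E then C (s (i, j)) * X (i, j) else 0 :
        Matrix (Fin m') (Fin m') (MvPolynomial (Fin m' × Fin m') k)) =
      M.submatrix e.symm e.symm := by
    ext p q
    obtain ⟨p', rfl⟩ := e.surjective p
    obtain ⟨q', rfl⟩ := e.surjective q
    simp only [AlgHom.mapMatrix_apply, Matrix.map_apply, Matrix.of_apply, Matrix.submatrix_apply,
      Equiv.symm_apply_apply]
    rw [apply_ite (aeval proj), map_zero, map_mul, aeval_C, aeval_X, hproj, hs,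
      MvPolynomial.algebraMap_eq]
    have hmem := hE (e p') (e q')
    rcases p' with u | x <;> rcases q' with u' | y
    · -- internal block `1 - Λ`
      simp only [Sum.elim_inl, M, Matrix.fromBlocks_apply₁₁, Matrix.sub_apply]
      have ho1 : e (Sum.inl u) ≠ o := fun h => Sum.inl_ne_inr ((heo _).1 h)
      have ho2 : e (Sum.inl u') ≠ o := fun h => Sum.inl_ne_inr ((heo _).1 h)
      by_cases huu : u = u'
      · subst huu
        rw [if_pos (hmem.2 (Or.inr (Or.inr ⟨ho1, ho1, Or.inl rfl⟩))), if_neg (fun h => h.2 rfl),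
          if_pos rfl, Matrix.one_apply_eq, hzero u u (lt_irrefl _), sub_zero, C_1, one_mul]
      · have hne : e (Sum.inl u) ≠ e (Sum.inl u') := fun h => huu (Sum.inl_injective (e.injective h))
        rw [if_neg huu, Matrix.one_apply_ne huu, zero_sub]
        by_cases hr : r u < r u'
        · rw [if_pos (hmem.2 (Or.inr (Or.inr ⟨ho1, ho2, Or.inr (by rwa [hr', hr'])⟩))),
            if_pos ⟨ho1, hne⟩, C_neg, C_1, neg_one_mul]
        · rw [hzero u u' hr, neg_zero, if_neg]
          intro h
          rcases hmem.1 h with h' | h' | h'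
          · exact ho2 h'.2
          · exact ho1 h'.1
          · rcases h'.2.2 with h'' | h''
            · exact hne h''
            · rw [hr', hr'] at h''; exact hr h''
    · -- column of the super-vertex: `-w`
      simp only [Sum.elim_inl, Sum.elim_inr, M, Matrix.fromBlocks_apply₁₂, Matrix.neg_apply,
        Matrix.replicateCol_apply]
      have ho1 : e (Sum.inl u) ≠ o := fun h => Sum.inl_ne_inr ((heo _).1 h)
      have ho2 : e (Sum.inr y) = o := (heo _).2 rfl
      rw [if_pos (hmem.2 (Or.inl ⟨ho1, ho2⟩)), if_pos ⟨ho1, fun h => ho1 (h.trans ho2)⟩, C_neg, C_1,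
        neg_one_mul]
    · -- row of the super-vertex: `v`
      simp only [Sum.elim_inl, Sum.elim_inr, M, Matrix.fromBlocks_apply₂₁,
        Matrix.replicateRow_apply]
      have ho1 : e (Sum.inr x) = o := (heo _).2 rfl
      have ho2 : e (Sum.inl u') ≠ o := fun h => Sum.inl_ne_inr ((heo _).1 h)
      rw [if_pos (hmem.2 (Or.inr (Or.inl ⟨ho1, ho2⟩))), if_neg (fun h => h.1 ho1), C_1, one_mul]
    · simp only [Sum.elim_inr, M, Matrix.fromBlocks_apply₂₂, Matrix.zero_apply]
      have ho1 : e (Sum.inr x) = o := (heo _).2 rfl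
      rw [if_neg (fun h => ?_)]
      rcases hmem.1 h with h' | h' | h'
      · exact h'.1 ho1
      · exact h'.2 ((heo _).2 rfl)
      · exact h'.1 ho1
  rw [← hdet, AlgHom.map_det, hmap, Matrix.det_submatrix_equiv_self]
  -- Schur complement of the unipotent block
  letI : Invertible (1 - Λ) := invertibleOfRightInverse _ _ hG
  have hinv : ⅟(1 - Λ) = G := invOf_eq_right_inv hG
  simp only [M]
  rw [Matrix.det_fromBlocks₁₁, det_one_sub_eq_one_of_ranked r Λ hΛr, one_mul, Matrix.mul_neg,
    sub_neg_eq_add, zero_add, Matrix.mul_assoc, ← Matrix.replicateCol_mulVec,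
    Matrix.replicateRow_mul_replicateCol, Matrix.det_unique, Matrix.of_apply, hinv, hf]

end Summit.ValiantsHypothesis.ValiantsHypothesis.Theorems.PolyaContinued
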